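import Literature.NumberTheory.EllipticCurves.TwoDescent
import Literature.NumberTheory.EllipticCurves.QuadraticTwistRank
import HarnessLib

/-!
# LINE 49 «full_vertex» — TORSION CONTROL by complete `2`-descent (pen memo #4 §11, Lemma 11.1), descent form

Crux R″ `RankOneTwoTorsionResidualAtTwo` (stmt-BirchSwinnertonDyer-27478) of route GenusKolyvaginAtTwo, LINE 49
«torsion_cell_full_vertex_bsdidea1» (pen bsd-idea-1).  SUPPORT mathematics for the line's research stubs F0aJ′ / F0bJ
(the lower/upper bounds «`y_K ∈ 2^{k−1}E₀(K″) + tors`» of memo #4 §12 / memo #5 §5 / memo #6 need `E₀(K″)[2^∞] =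
E₀(ℚ)[2^∞]` and `E₀(ℚ) ∩ 2E₀(K″) = 2E₀(ℚ)` for the genus fields `K″ = ℚ(√−p₀M₀)`): this file hosts, DEF-FREE, §1–§4 and
§6a of the pen's HOME-only brick `line49/engine/TorsionControl.lean` r3 (W-79: the pen may not propose).  The base
change of points is the tree's `WeierstrassCurve.QuadraticDescent.incl L W : E(K) →+ E(L)` (Mathlib's `Point.baseChange`, `QuadraticTwistRank.lean`).

Let `E/K` (`char K = 0`) be a Weierstrass model `W` with RATIONAL `2`-TORSION, `W.toAffine.SplitTwoTorsion e₁ e₂ e₃`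
(tree `Literature/NumberTheory/EllipticCurves/TwoDescent.lean`), and `L ⊇ K` any field extension.

* §1 `mem_of_two_pow_smul_eq_zero` — the group-theoretic skeleton of Lemma 11.1 (ii): for abelian groups `A ≤ B` with
  `B[2] ⊆ A` and `A ∩ 2B ⊆ 2A`, every `2`-power-torsion element of `B` lies in `A`.
* §2 `splitTwoTorsion_baseChange` — the rational `2`-torsion data base-change.
* §3 `exists_add_self_of_map` — **Lemma 11.1 (i) in descent form**: if the KUMMER VALUES of the `K`-points (`x − e₁`,
  `x − e₂`, and the torsion values `(e₁−e₂)(e₁−e₃)`, `(e₂−e₁)(e₂−e₃)`; Silverman AEC X.1.4) lie in a set `S ⊆ K` which is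
  SQUARE-REFLECTING in `L` (no element of `S` becomes a square in `L` unless it is a square in `K`), then
  `E(K) ∩ 2E(L) = 2E(K)`.  Mechanism: the `L`-descent components of `R = 2Q` vanish (`twoDescentComponent_add`, tree),
  square-reflection pulls this back to `K`, and the tree's `exists_add_self_of_twoDescentComponent_eq_one` halves `R`.
* §4 `mem_range_map_of_add_self_eq_zero` — `E(L)[2] ⊆ E(K)`; `mem_range_map_of_two_pow_smul_eq_zero` — **Lemma 11.1
  (ii)**: `E(L)[2^∞] = E(K)[2^∞]`; `mem_range_map_of_add_self_eq_map` — (iii) halves in `E(L)` of `K`-points are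
  `K`-rational.
* §6a (any `char 0` base) `exists_sq_or_mul_sq_of_quadratic`: an element of `K` that becomes a square in `K(r)`,
  `r² = D`, lies in `K² ∪ D·K²`; `mem_or_div_mem_of_isSquare_step`: the one-step tower lemma (multiquadratic hook).

The RAMIFICATION INPUT («`δ ∈ ℚ(S₀,2) ∖ {1}` is not a square in any `L/ℚ` unramified at `S₀`») is NOT proved here; it is
the square-reflection hypothesis `hL`.  The sequel `…TorsionControlQuadratic` discharges it for `K = ℚ`, `L = ℚ(√D)`
ramified at a good prime (the `K″` layer of the line).  Everything is proved (no `sorry`, standard axioms); nothing here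
is a statement of the line, and NOTHING HERE PROVES R″ or any summit — BSD is not advanced by this file alone.

## References

* [SilvermanAEC2009] J. H. Silverman, *The Arithmetic of Elliptic Curves*, 2nd ed., GTM 106 (2009), Thm. X.1.1 /
  Prop. X.1.4 (complete `2`-descent), VIII.§1.
* [Kramer1981] K. Kramer, *Arithmetic of elliptic curves upon quadratic extension*, Trans. AMS 264 (1981) — `E(K)` vs
  `E(L)` in quadratic extensions.
-/

open WeierstrassCurve WeierstrassCurve.Affine
open WeierstrassCurve.Affine.Point hiding some
open WeierstrassCurve.QuadraticDescent (incl)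
open scoped Classical

noncomputable section

namespace Summit.BirchSwinnertonDyer.BirchSwinnertonDyer.Theorems.GenusKolyvaginAtTwo.FullVertex.TorsionControl

/-! ## §1 The group-theoretic skeleton of Lemma 11.1 (ii) -/

/-- **`2`-saturation + rational `2`-torsion ⟹ rational `2^∞`-torsion.** Let `A ≤ B` be abelian groups with
`B[2] ⊆ A` and `A ∩ 2B ⊆ 2A`. Then every element of `B` killed by a power of `2` lies in `A`.
[cite: SilvermanAEC2009, Prop. X.1.4] -/
theorem mem_of_two_pow_smul_eq_zero {B : Type*} [AddCommGroup B] (A : AddSubgroup B)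
    (h2 : ∀ b : B, 2 • b = 0 → b ∈ A) (hsat : ∀ b : B, 2 • b ∈ A → ∃ a ∈ A, 2 • a = 2 • b)
    {m : ℕ} {b : B} (hb : 2 ^ m • b = 0) : b ∈ A := by
  induction m generalizing b with
  | zero =>
    rw [pow_zero, one_smul] at hb
    rw [hb]; exact A.zero_mem
  | succ m ih =>
    have h2b : 2 • b ∈ A := ih (by rwa [smul_smul, ← pow_succ])
    obtain ⟨a, ha, h2a⟩ := hsat b h2b
    have hba : b - a ∈ A := h2 (b - a) (by rw [smul_sub, h2a, sub_self])
    simpa using A.add_mem hba ha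

/-! ## §2 Base change of the rational `2`-torsion data -/

section Descent

variable {K L : Type*} [Field K] [Field L] [Algebra K L] [CharZero K] [CharZero L]
  {W : WeierstrassCurve K} {e₁ e₂ e₃ : K}

omit [CharZero K] [CharZero L] in
/-- Rational `2`-torsion data base-changes. [cite: SilvermanAEC2009, Prop. X.1.4] -/
theorem splitTwoTorsion_baseChange (h : W.toAffine.SplitTwoTorsion e₁ e₂ e₃) :
    (W.baseChange L).toAffine.SplitTwoTorsion (algebraMap K L e₁) (algebraMap K L e₂)
      (algebraMap K L e₃) := by
  refine ⟨?_, ?_, ?_⟩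
  · have hb : (W.baseChange L).toAffine.b₂ = algebraMap K L W.b₂ := W.map_b₂ _
    rw [hb, show W.b₂ = -4 * (e₁ + e₂ + e₃) from h.b₂_eq, map_mul, map_neg, map_ofNat, map_add,
      map_add]
  · have hb : (W.baseChange L).toAffine.b₄ = algebraMap K L W.b₄ := W.map_b₄ _
    rw [hb, show W.b₄ = 2 * (e₁ * e₂ + e₁ * e₃ + e₂ * e₃) from h.b₄_eq, map_mul, map_ofNat, map_add,
      map_add, map_mul, map_mul, map_mul]
  · have hb : (W.baseChange L).toAffine.b₆ = algebraMap K L W.b₆ := W.map_b₆ _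
    rw [hb, show W.b₆ = -4 * (e₁ * e₂ * e₃) from h.b₆_eq, map_mul, map_neg, map_ofNat, map_mul,
      map_mul]

/-! ## §3 Lemma 11.1 (i), descent form: `E(K) ∩ 2E(L) = 2E(K)` from square-reflection on the Kummer values -/

variable [W.IsElliptic]

omit [CharZero K] [CharZero L] in
/-- One descent component: if the `L`-component of the base change of a `K`-point `R` at `T₁ = (f₁, *)` is
trivial, and the relevant Kummer values (`(f₁−f₂)(f₁−f₃)` and the `x − f₁`) lie in a set `S ⊆ K` no element of
which becomes a square in `L` without being one in `K`, then the `K`-component of `R` at `T₁` is trivial.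
[cite: SilvermanAEC2009, Prop. X.1.4] -/
theorem twoDescentComponent_eq_one_of_map {f₁ f₂ f₃ : K} (h : W.toAffine.SplitTwoTorsion f₁ f₂ f₃)
    (S : Set K) (hc : (f₁ - f₂) * (f₁ - f₃) ∈ S)
    (hx : ∀ {x y : K}, W.toAffine.Nonsingular x y → x ≠ f₁ → x - f₁ ∈ S)
    (hL : ∀ a ∈ S, (∃ w : L, algebraMap K L a = w ^ 2) → ∃ u : K, a = u ^ 2)
    (R : W.toAffine.Point)
    (h1 : twoDescentComponent (W.baseChange L).toAffine (algebraMap K L f₁) (algebraMap K L f₂)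
      (algebraMap K L f₃) (incl L W R) = 1) :
    twoDescentComponent W.toAffine f₁ f₂ f₃ R = 1 := by
  rcases R with _ | ⟨x, y, hxy⟩
  · rfl
  · -- read the `L`-component on the clean base-changed point `(x, y) ∈ E(L)`
    suffices key : ∀ hP : (W.baseChange L).toAffine.Nonsingular (algebraMap K L x) (algebraMap K L y),
        twoDescentComponent (W.baseChange L).toAffine (algebraMap K L f₁) (algebraMap K L f₂)
          (algebraMap K L f₃) (Point.some _ _ hP) = 1 →
        twoDescentComponent W.toAffine f₁ f₂ f₃ (Point.some x y hxy) = 1 from key _ h1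
    intro hP h1
    by_cases hx₁ : x = f₁
    · -- at `T₁`: the component is `(f₁ - f₂)(f₁ - f₃)`
      have hxL : algebraMap K L x = algebraMap K L f₁ := by rw [hx₁]
      rw [twoDescentComponent_some_of_eq hP hxL, ← map_sub, ← map_sub, ← map_mul,
        sqClass_eq_one_iff ((map_ne_zero _).mpr h.c_ne_zero)] at h1
      rw [twoDescentComponent_some_of_eq hxy hx₁, sqClass_eq_one_iff h.c_ne_zero]
      exact hL _ hc h1
    · have hxL : algebraMap K L x ≠ algebraMap K L f₁ := fun e =>
        hx₁ ((algebraMap K L).injective e)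
      have hx0 : x - f₁ ≠ 0 := sub_ne_zero.mpr hx₁
      rw [twoDescentComponent_some_of_ne hP hxL, ← map_sub,
        sqClass_eq_one_iff ((map_ne_zero _).mpr hx0)] at h1
      rw [twoDescentComponent_some_of_ne hxy hx₁, sqClass_eq_one_iff hx0]
      exact hL _ (hx hxy hx₁) h1

/-- **Lemma 11.1 (i) (`2`-saturation), descent form.** Let `E/K` have rational `2`-torsion `e₁, e₂, e₃` and let
`S ⊆ K` contain the Kummer values of the `K`-points: `(e₁−e₂)(e₁−e₃)`, `(e₂−e₁)(e₂−e₃)`, and `x − e₁`, `x − e₂`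
for every `K`-point `(x, y)` with `x ≠ e₁` resp. `x ≠ e₂` (over a number field: `S = K(S₀, 2)` for the bad set
`S₀`, Silverman AEC X.1.4).  If no element of `S` becomes a square in `L` unless it is a square in `K` (`hL`, the
RAMIFICATION INPUT, kept as a hypothesis), then `E(K) ∩ 2E(L) = 2E(K)`: a `K`-point halvable in `E(L)` is
halvable in `E(K)`. [cite: SilvermanAEC2009, Prop. X.1.4] -/
theorem exists_add_self_of_map (h : W.toAffine.SplitTwoTorsion e₁ e₂ e₃) (S : Set K)
    (hS₁ : (e₁ - e₂) * (e₁ - e₃) ∈ S) (hS₂ : (e₂ - e₁) * (e₂ - e₃) ∈ S)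
    (hS : ∀ {x y : K}, W.toAffine.Nonsingular x y → (x ≠ e₁ → x - e₁ ∈ S) ∧ (x ≠ e₂ → x - e₂ ∈ S))
    (hL : ∀ a ∈ S, (∃ w : L, algebraMap K L a = w ^ 2) → ∃ u : K, a = u ^ 2)
    (R : W.toAffine.Point)
    (hR : ∃ Q : (W.baseChange L).toAffine.Point, Q + Q = incl L W R) :
    ∃ P : W.toAffine.Point, P + P = R := by
  haveI : (W.baseChange L).IsElliptic := inferInstanceAs ((W.map (algebraMap K L)).IsElliptic)
  have hL' := splitTwoTorsion_baseChange (L := L) h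
  obtain ⟨Q, hQ⟩ := hR
  refine exists_add_self_of_twoDescentComponent_eq_one h R ?_ ?_
  · refine twoDescentComponent_eq_one_of_map h S hS₁ (fun hxy hx => (hS hxy).1 hx) hL R ?_
    rw [← hQ, twoDescentComponent_add hL', SqUnits.mul_self]
  · refine twoDescentComponent_eq_one_of_map h.swap₁₂ S hS₂ (fun hxy hx => (hS hxy).2 hx) hL R ?_
    rw [← hQ, twoDescentComponent_add hL'.swap₁₂, SqUnits.mul_self]

/-! ## §4 Lemma 11.1 (ii): `E(L)[2^∞] = E(K)[2^∞]` -/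

omit [CharZero K] [CharZero L] [W.IsElliptic] in
/-- The `y`-coordinate of a `2`-torsion point base-changes. [cite: SilvermanAEC2009, Prop. X.1.4] -/
theorem algebraMap_twoTorsionY (e : K) :
    algebraMap K L (W.toAffine.twoTorsionY e) = (W.baseChange L).toAffine.twoTorsionY (algebraMap K L e) := by
  simp only [twoTorsionY, map_div₀, map_neg, map_add, map_mul, map_ofNat]
  rfl

/-- A point of `E(L)` whose `x`-coordinate is a rational `2`-torsion abscissa `f₁` is the base change of the
`K`-point `T₁ = (f₁, −(a₁f₁ + a₃)/2)`. [cite: SilvermanAEC2009, Prop. X.1.4] -/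
theorem some_mem_range_map_of_eq {f₁ f₂ f₃ : K} (h : W.toAffine.SplitTwoTorsion f₁ f₂ f₃) {x y : L}
    (hxy : (W.baseChange L).toAffine.Nonsingular x y) (hx : x = algebraMap K L f₁) :
    Point.some x y hxy ∈ (incl L W).range := by
  haveI : (W.baseChange L).IsElliptic := inferInstanceAs ((W.map (algebraMap K L)).IsElliptic)
  subst hx
  obtain rfl := eq_twoTorsionY_of_eq (splitTwoTorsion_baseChange (L := L) h) hxy
  refine ⟨Point.some f₁ (W.toAffine.twoTorsionY f₁) (nonsingular_twoTorsion h), ?_⟩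
  change Point.some (algebraMap K L f₁) (algebraMap K L (W.toAffine.twoTorsionY f₁)) _ = _
  congr 1
  exact algebraMap_twoTorsionY f₁

/-- **The `2`-torsion of `E(L)` is `K`-rational** when `E[2] ⊆ E(K)`: a point `Q ∈ E(L)` with `2Q = O` is `O` or
one of the `Tᵢ = (eᵢ, −(a₁eᵢ + a₃)/2)`, all in the image of `E(K)`. [cite: SilvermanAEC2009, Prop. X.1.4] -/
theorem mem_range_map_of_add_self_eq_zero (h : W.toAffine.SplitTwoTorsion e₁ e₂ e₃)
    (Q : (W.baseChange L).toAffine.Point) (hQ : Q + Q = 0) :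
    Q ∈ (incl L W).range := by
  haveI : (W.baseChange L).IsElliptic := inferInstanceAs ((W.map (algebraMap K L)).IsElliptic)
  have hL' := splitTwoTorsion_baseChange (L := L) h
  rcases Q with _ | ⟨x, y, hxy⟩
  · exact ⟨0, rfl⟩
  · -- `Q = -Q`, so `2y + a₁x + a₃ = 0`, so `x` is a root of the `2`-division cubic `∏ (x - eᵢ)`
    have hneg : y = (W.baseChange L).toAffine.negY x y := by
      by_contra hy
      rw [add_self_of_Y_ne hy] at hQ
      exact some_ne_zero _ hQ
    have hy0 : y + ((W.baseChange L).toAffine.a₁ * x + (W.baseChange L).toAffine.a₃) / 2 = 0 := by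
      rw [negY] at hneg
      linear_combination (1 / 2 : L) * hneg
    have hcubic := sq_eq_mul_mul_of_equation hL' hxy.1
    rw [hy0, zero_pow two_ne_zero, eq_comm, mul_eq_zero, mul_eq_zero, sub_eq_zero, sub_eq_zero,
      sub_eq_zero] at hcubic
    rcases hcubic with (hx | hx) | hx
    · exact some_mem_range_map_of_eq h hxy hx
    · exact some_mem_range_map_of_eq h.swap₁₂ hxy hx
    · exact some_mem_range_map_of_eq h.swap₂₃.swap₁₂ hxy hx

/-- **Lemma 11.1 (ii) (torsion control).** Under the hypotheses of `exists_add_self_of_map` (rational `2`-torsion; no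
Kummer value of a `K`-point becomes a square in `L` without being one in `K`), every point of `E(L)` killed by a
power of `2` comes from `E(K)`: `E(L)[2^∞] = E(K)[2^∞]`. [cite: SilvermanAEC2009, Prop. X.1.4] -/
theorem mem_range_map_of_two_pow_smul_eq_zero (h : W.toAffine.SplitTwoTorsion e₁ e₂ e₃) (S : Set K)
    (hS₁ : (e₁ - e₂) * (e₁ - e₃) ∈ S) (hS₂ : (e₂ - e₁) * (e₂ - e₃) ∈ S)
    (hS : ∀ {x y : K}, W.toAffine.Nonsingular x y → (x ≠ e₁ → x - e₁ ∈ S) ∧ (x ≠ e₂ → x - e₂ ∈ S))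
    (hL : ∀ a ∈ S, (∃ w : L, algebraMap K L a = w ^ 2) → ∃ u : K, a = u ^ 2)
    (Q : (W.baseChange L).toAffine.Point) {m : ℕ} (hQ : 2 ^ m • Q = 0) :
    Q ∈ (incl L W).range := by
  refine mem_of_two_pow_smul_eq_zero (incl L W).range ?_ ?_ hQ
  · intro b hb
    rw [two_nsmul] at hb
    exact mem_range_map_of_add_self_eq_zero h b hb
  · rintro b ⟨R, hR⟩
    obtain ⟨P, hP⟩ := exists_add_self_of_map h S hS₁ hS₂ hS hL R ⟨b, by rw [hR, two_nsmul]⟩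
    exact ⟨incl L W P, ⟨P, rfl⟩, by rw [two_nsmul, ← map_add, hP, hR]⟩

/-- **Lemma 11.1 (iii): halves are rational.** Under the same hypotheses, every half in `E(L)` of a `K`-point is
`K`-rational: `Q + Q = R ∈ E(K) ⟹ Q ∈ E(K)` (from (i) and `E(L)[2] ⊆ E(K)`). [cite: SilvermanAEC2009, Prop. X.1.4] -/
theorem mem_range_map_of_add_self_eq_map (h : W.toAffine.SplitTwoTorsion e₁ e₂ e₃) (S : Set K)
    (hS₁ : (e₁ - e₂) * (e₁ - e₃) ∈ S) (hS₂ : (e₂ - e₁) * (e₂ - e₃) ∈ S)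
    (hS : ∀ {x y : K}, W.toAffine.Nonsingular x y → (x ≠ e₁ → x - e₁ ∈ S) ∧ (x ≠ e₂ → x - e₂ ∈ S))
    (hL : ∀ a ∈ S, (∃ w : L, algebraMap K L a = w ^ 2) → ∃ u : K, a = u ^ 2)
    (R : W.toAffine.Point) (Q : (W.baseChange L).toAffine.Point)
    (hQ : Q + Q = incl L W R) :
    Q ∈ (incl L W).range := by
  obtain ⟨P, hP⟩ := exists_add_self_of_map h S hS₁ hS₂ hS hL R ⟨Q, hQ⟩
  have h0 : (Q - incl L W P) + (Q - incl L W P)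
      = 0 := by
    rw [sub_add_sub_comm, hQ, ← map_add, hP, sub_self]
  obtain ⟨T, hT⟩ := mem_range_map_of_add_self_eq_zero h _ h0
  exact ⟨T + P, by rw [map_add, hT, sub_add_cancel]⟩

end Descent

/-! ## §6a Squares in a quadratic extension (any base field of characteristic `0`) -/

section Quadratic

variable {K L : Type*} [Field K] [CharZero K] [Field L] [Algebra K L]

/-- In a quadratic extension `L = K(r)` (`char K = 0`, `r² = D ∈ K`; `r ∈ K` allowed), an element of `K`
which becomes a square in `L` lies in `K² ∪ D·K²`. [cite: Kramer1981, §1] -/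
theorem exists_sq_or_mul_sq_of_quadratic {D : K} {r : L} (hr : r ^ 2 = algebraMap K L D)
    (hgen : ∀ w : L, ∃ a b : K, w = algebraMap K L a + algebraMap K L b * r) {c : K}
    (hc : ∃ w : L, algebraMap K L c = w ^ 2) : ∃ u : K, c = u ^ 2 ∨ c = D * u ^ 2 := by
  obtain ⟨w, hw⟩ := hc
  obtain ⟨a, b, rfl⟩ := hgen w
  have key : algebraMap K L (c - a ^ 2 - D * b ^ 2) = algebraMap K L (2 * a * b) * r := by
    rw [map_sub, map_sub, hw, map_mul, map_pow, map_mul, map_mul, map_pow, map_ofNat]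
    linear_combination (algebraMap K L b) ^ 2 * hr
  by_cases hab : 2 * a * b = 0
  · rw [hab, _root_.map_zero, zero_mul, map_eq_zero_iff _ (algebraMap K L).injective] at key
    rcases mul_eq_zero.mp hab with ha | hb
    · have ha0 : a = 0 := by simpa using ha
      exact ⟨b, Or.inr (by rw [ha0] at key; linear_combination key)⟩
    · exact ⟨a, Or.inl (by rw [hb] at key; linear_combination key)⟩
  · -- `r ∈ K`: then `c = (a + b r)²` is a square in `K`
    have hr' : r = algebraMap K L ((c - a ^ 2 - D * b ^ 2) / (2 * a * b)) := by
      rw [map_div₀, key, mul_div_cancel_left₀ _ ((map_ne_zero _).mpr hab)]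
    refine ⟨a + b * ((c - a ^ 2 - D * b ^ 2) / (2 * a * b)), Or.inl ((algebraMap K L).injective ?_)⟩
    rw [hw, hr', ← map_mul, ← map_add, map_pow]

omit [CharZero K] in
/-- **One step up a tower of quadratic extensions** `K ⊆ L ⊆ M = L(r)`, `r² = d ∈ K`: if every element of `K`
that is a square in `L` lies in `G ⊆ K`, then every `c ∈ K` that is a square in `M` satisfies
`c ∈ G ∨ (d ≠ 0 ∧ c/d ∈ G)`.  Iterating from `G₀ = K²` describes the elements of `K` that become squares in a
multiquadratic field `K(√d₁, …, √d_t)` as `⟨d₁, …, d_t⟩·K²` — the hook for the GENUS FIELD layer of memo #4 §11.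
[cite: Kramer1981, §1] -/
theorem mem_or_div_mem_of_isSquare_step {M : Type*} [Field M] [Algebra K M] [Algebra L M]
    [IsScalarTower K L M] [CharZero L] {d : K} {r : M} (hr : r ^ 2 = algebraMap K M d)
    (hgen : ∀ w : M, ∃ a b : L, w = algebraMap L M a + algebraMap L M b * r)
    {G : Set K} (hG : ∀ c : K, (∃ s : L, algebraMap K L c = s ^ 2) → c ∈ G)
    {c : K} (hc : ∃ w : M, algebraMap K M c = w ^ 2) : c ∈ G ∨ (d ≠ 0 ∧ c / d ∈ G) := by
  have hr' : r ^ 2 = algebraMap L M (algebraMap K L d) := by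
    rw [hr, IsScalarTower.algebraMap_apply K L M]
  obtain ⟨w, hw⟩ := hc
  have hc' : ∃ w : M, algebraMap L M (algebraMap K L c) = w ^ 2 :=
    ⟨w, by rw [← IsScalarTower.algebraMap_apply]; exact hw⟩
  obtain ⟨u, hu | hu⟩ := exists_sq_or_mul_sq_of_quadratic (K := L) hr' hgen hc'
  · exact Or.inl (hG c ⟨u, hu⟩)
  · by_cases hd : d = 0
    · refine Or.inl (hG c ⟨0, ?_⟩)
      rw [hu, hd, _root_.map_zero, zero_mul, zero_pow two_ne_zero]
    · refine Or.inr ⟨hd, hG _ ⟨u, ?_⟩⟩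
      rw [map_div₀, hu, mul_div_cancel_left₀ _ ((map_ne_zero _).mpr hd)]

end Quadratic

end Summit.BirchSwinnertonDyer.BirchSwinnertonDyer.Theorems.GenusKolyvaginAtTwo.FullVertex.TorsionControl

end
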